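import Summits.HodgeConjecture.HodgeConjecture.Theses.TropicalWeilObstruction
import Summits.HodgeConjecture.HodgeConjecture.Theorems.TropicalWeilObstructionTropicalWeilVanishingIntegrality
import Summits.HodgeConjecture.HodgeConjecture.Theorems.TropicalWeilObstructionTropicalWeilVanishingDegreeLadder
import Summits.HodgeConjecture.HodgeConjecture.Theorems.TropicalWeilObstructionTropicalWeilVanishingFrameSpanMaster
import HarnessLib

/-!
# Route `TropicalWeilObstruction` (Kontsevich's tropical test — NEGATION SINK, exploration, no summit claim):
# full integrality of the tropical cycle class — IV. effective classes are integral Hodge classes; the rung at degree `8`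

Negation-sink bookkeeping of the cell `pub-hodge-tropical` (seat tropical-2 gen 6); part IV (corollaries) of FULL INTEGRALITY
`24 ∣ intCoord Z` (part III: `Integrality.twentyFour_dvd_intCoord`), combined with tropical-1's DEGREE LADDER part II
(`…TropicalWeilVanishingDegreeLadder`, p344212: the general rung `Ladder.weilFunctional_eq_zero_of_thetaCoord_lt_of_dvd` and the
degree-`8` statements, which carried `24 ∣ intCoord Z` as a HYPOTHESIS). Setting: a very general principally polarised
tropical Weil eightfold `ℝ⁸/Qℤ⁸` (`Q ≻ 0`, `QJ = JQ`, `IsWeilGeneric 4 Q`), an effective tropical `4`-cycle `Z`, K3's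
coordinates `cyc Z = q₀ θ₄(Q) + q₁ Re w(Q) + q₂ Im w(Q)`.

* **`cyc_mem_intLattice`** — `cyc Z = a θ₄(Q) + b Re w(Q) + c Im w(Q)` with `a, b, c ∈ ℤ`: the class of every effective tropical
  `4`-cycle is an INTEGRAL Hodge class (tropical-2's `integralHodgeClass_iff`, p335583, says these are exactly
  `ℤθ₄ ⊕ ℤRe w ⊕ ℤIm w`); K3 alone gave `(1/24)ℤ³`, the ladder's part I `(1/6)ℤ³`;
* `latticePoint_int` — moreover `a ≥ 0` and `64 (b² + c²) ≤ a²` (calibration cone, p332805): the effective classes lie on the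
  LATTICE POINTS of the cone; `thetaCoord_pos_int` — `a ≥ 1` if `Z` is non-empty (row (F), `FrameSpan.exists_coordinates_pos`);
* **`weilFunctional_eq_zero_of_thetaCoord_lt_eight`** — THE RUNG, now unconditional: `q₀ < 8 ⟹ W(Z) = 0`
  (`a ≤ 7 ⟹ 64(b²+c²) ≤ 49 ⟹ b = c = 0`); `thetaCoord_ge_eight_of_weilFunctional_ne_zero` — a counterexample to K1 has
  theta-degree `q₀ ≥ 8`; intrinsically `mass_ge_of_weilFunctional_ne_zero_int` — hermitian mass `μ(Z) ≥ 8 · det(P Q Pᴴ)`;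
* `weilCoords_sq_eq_one_of_thetaCoord_eq_eight` — unconditional: a counterexample of theta-degree exactly `8` has class
  `8θ₄ ± Re w` or `8θ₄ ± Im w`, ON THE BOUNDARY of the calibration cone — exactly the κ = 8 classes (p337681, p340882, p342567),
  which pass every integrality-and-positivity test.

HONEST STATUS. K1 (`TropicalWeilVanishing`, stmt-HodgeConjecture-18478) is an OPEN problem; these are necessary conditions on a
counterexample (equivalently: K1 holds for effective cycles of theta-degree `< 8` — a family with NO KNOWN MEMBER at a generic
period: the smallest theta-degree of a known effective cycle with class on the axis is `24`, `Θ⁴`; the rung may be vacuous).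
Nothing here decides K1 or bears on the Hodge conjecture. No definition (display-only notation), no named fact, no sorry.
References: [MikhalkinZharkov2014Eigenwave] G. Mikhalkin, I. Zharkov, LN UMI 15 (2014), Def. 4.2, Prop. 4.3, Thm. 5.4;
[Zharkov2020TropicalWeil] I. Zharkov, arXiv:2002.02347, §2 (pp. 2–4).
-/

set_option linter.dupNamespace false

noncomputable section

open scoped BigOperators
open Matrix
open Literature.AlgebraicGeometry.Tropical
open Summit.HodgeConjecture.HodgeConjecture.Theorems.TropicalHodgeBound

namespace Summit.HodgeConjecture.HodgeConjecture.Theorems.TropicalWeilVanishing.Integrality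

/-! ## §0 Display-only notation (the K3 skeleton's local definitions, verbatim bodies; nothing is defined) -/

/-- `P = [1 | i·1]`, the `n × 2n` matrix of `dz₁ ∧ … ∧ dz_n`. -/
local notation3 (prettyPrint := false) "𝐏⟦" n "⟧" =>
  (Matrix.of fun (k : Fin n) (a : Fin (2 * n)) =>
    (if (a : ℕ) = (k : ℕ) then (1 : ℂ) else 0) + (if (a : ℕ) = (k : ℕ) + n then Complex.I else 0))

/-- The skeleton's `thetaClass n Q`. -/
local notation3 (prettyPrint := false) "θ⟦" n "⟧" Q:max =>
  (fun S S' : Fin n → Fin (2 * n) => Matrix.det (Matrix.submatrix Q S S'))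

/-- The skeleton's `omegaFrame n` (`Ω = Pᴴ`). -/
local notation3 (prettyPrint := false) "Ω⟦" n "⟧" =>
  (Matrix.of fun (a : Fin (2 * n)) (b : Fin n) =>
    (if (a : ℕ) = (b : ℕ) then (1 : ℂ) else 0) - (if (a : ℕ) = (b : ℕ) + n then Complex.I else 0))

/-- The skeleton's `weilClassC n Q` (`w(Q) = (⋀ⁿQ ⊗ 1)(Ω ⊗ Ω)`). -/
local notation3 (prettyPrint := false) "wC⟦" n "⟧" Q:max =>
  (fun S S' : Fin n → Fin (2 * n) =>
    Matrix.det (Matrix.submatrix (Matrix.map Q ((↑) : ℝ → ℂ) * Ω⟦n⟧) S id) *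
      Matrix.det (Matrix.submatrix (Ω⟦n⟧) S' id))

/-- The skeleton's `weilClassRe n Q` (`w₁ = Re w`). -/
local notation3 (prettyPrint := false) "wRe⟦" n "⟧" Q:max =>
  (fun S S' : Fin n → Fin (2 * n) => Complex.re ((wC⟦n⟧ Q) S S'))

/-- The skeleton's `weilClassIm n Q` (`w₂ = Im w`). -/
local notation3 (prettyPrint := false) "wIm⟦" n "⟧" Q:max =>
  (fun S S' : Fin n → Fin (2 * n) => Complex.im ((wC⟦n⟧ Q) S S'))

/-- NEW display-only notation: the hermitian MASS `μ(Z) = Σ_σ w_σ a_σ |η_σ|²` of an effective tropical `4`-cycle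
(the value of `dz ⊗ dz̄` on `cyc Z`, `hermPairing_cyc`). Nothing is defined. -/
local notation3 (prettyPrint := false) "μ⟦" Z "⟧" =>
  (∑ σ, ((TropicalTorusCycle.cell Z σ).weight : ℝ) * (TropicalTorusCycle.cell Z σ).latticeVolume *
    ‖frameComplexDet 4 (TropicalTorusCycle.cell Z σ).frame‖ ^ 2)

variable (Q : Matrix (Fin (2 * 4)) (Fin (2 * 4)) ℝ)

/-! ## §1 Effective classes are integral Hodge classes -/

/-- **The class of an effective tropical `4`-cycle at a very general Weil period is an INTEGRAL Hodge class**: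
`cyc Z = a θ₄(Q) + b Re w(Q) + c Im w(Q)` with `a, b, c ∈ ℤ` (`24 ∣ intCoord Z`, part III, fed to the ladder's
`exists_int_coordinates_of_dvd`). [cite: MikhalkinZharkov2014Eigenwave, Prop. 4.3 and Thm. 5.4] [cite: Zharkov2020TropicalWeil, §2] -/
theorem cyc_mem_intLattice (hQ : Q.PosDef) (hJ : Q * weilJ 4 = weilJ 4 * Q) (hgen : IsWeilGeneric 4 Q)
    (Z : TropicalTorusCycle (2 * 4) 4 Q) :
    ∃ a b c : ℤ, Z.cyc = (a : ℝ) • θ⟦4⟧ Q + (b : ℝ) • wRe⟦4⟧ Q + (c : ℝ) • wIm⟦4⟧ Q := by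
  have hdet : IsUnit Q.det := hQ.det_pos.ne'.isUnit
  obtain ⟨a, b, c, h⟩ := Ladder.exists_int_coordinates_of_dvd Q hQ hJ hgen Z 24 (by norm_num)
    (fun I S' => twentyFour_dvd_intCoord hdet Z I S')
  refine ⟨a, b, c, ?_⟩
  rw [← h]
  norm_num

/-- **Lattice points of the cone**: `cyc Z = a θ₄(Q) + b Re w(Q) + c Im w(Q)` with integers `a ≥ 0`, `64 (b² + c²) ≤ a²`.
[cite: Zharkov2020TropicalWeil, §2] [cite: MikhalkinZharkov2014Eigenwave, Prop. 4.3 and Thm. 5.4] -/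
theorem latticePoint_int (hQ : Q.PosDef) (hJ : Q * weilJ 4 = weilJ 4 * Q) (hgen : IsWeilGeneric 4 Q)
    (Z : TropicalTorusCycle (2 * 4) 4 Q) :
    ∃ a b c : ℤ, Z.cyc = (a : ℝ) • θ⟦4⟧ Q + (b : ℝ) • wRe⟦4⟧ Q + (c : ℝ) • wIm⟦4⟧ Q ∧
      0 ≤ a ∧ 64 * (b ^ 2 + c ^ 2) ≤ a ^ 2 := by
  have hdet : IsUnit Q.det := hQ.det_pos.ne'.isUnit
  obtain ⟨a, b, c, h, ha, hcone⟩ := Ladder.latticePoint_of_dvd Q hQ hJ hgen Z 24 (by norm_num)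
    (fun I S' => twentyFour_dvd_intCoord hdet Z I S')
  refine ⟨a, b, c, ?_, ha, hcone⟩
  rw [← h]
  norm_num

/-- **The theta-degree of a NON-EMPTY effective cycle is a positive integer**: `cyc Z = a θ₄ + b Re w + c Im w` with
`a ≥ 1` (`a ∈ ℤ` here; `q₀ > 0` is row (F), `FrameSpan.exists_coordinates_pos`). [cite: Zharkov2020TropicalWeil, §2] -/
theorem thetaCoord_pos_int (hQ : Q.PosDef) (hJ : Q * weilJ 4 = weilJ 4 * Q) (hgen : IsWeilGeneric 4 Q)
    (Z : TropicalTorusCycle (2 * 4) 4 Q) (hZ : 0 < Z.numCells) :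
    ∃ a b c : ℤ, Z.cyc = (a : ℝ) • θ⟦4⟧ Q + (b : ℝ) • wRe⟦4⟧ Q + (c : ℝ) • wIm⟦4⟧ Q ∧
      1 ≤ a ∧ 64 * (b ^ 2 + c ^ 2) ≤ a ^ 2 := by
  obtain ⟨a, b, c, h, -, hcone⟩ := latticePoint_int Q hQ hJ hgen Z
  obtain ⟨q, hq, hq0, -⟩ := FrameSpan.exists_coordinates_pos Q hQ hJ hgen Z hZ
  obtain ⟨ea, -, -⟩ := Ladder.coords_unique Q hQ hJ (h.symm.trans hq)
  refine ⟨a, b, c, h, ?_, hcone⟩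
  have hq0R : (0 : ℝ) < ((q 0 : ℚ) : ℝ) := by exact_mod_cast hq0
  have haR : (0 : ℝ) < (a : ℝ) := by rw [ea]; exact hq0R
  have ha : 0 < a := by exact_mod_cast haR
  omega

/-! ## §2 The rung at theta-degree `8`, unconditionally -/

/-- **THE RUNG (unconditional): theta-degree `q₀ < 8` forces `W(Z) = 0`** on a very general principally polarised tropical
Weil eightfold (`24 ∣ intCoord Z` + calibration cone: the lattice point `(a,b,c)` has `a ≤ 7`, so `64(b²+c²) ≤ 49` forces
`b = c = 0`). K1 asserts `W = 0` for all `q₀`; by κ = 8 integrality and positivity prove nothing at `q₀ = 8`.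
[cite: Zharkov2020TropicalWeil, §2] [cite: MikhalkinZharkov2014Eigenwave, Prop. 4.3 and Thm. 5.4] -/
theorem weilFunctional_eq_zero_of_thetaCoord_lt_eight (hQ : Q.PosDef) (hJ : Q * weilJ 4 = weilJ 4 * Q)
    (hgen : IsWeilGeneric 4 Q) (Z : TropicalTorusCycle (2 * 4) 4 Q) {q₀ q₁ q₂ : ℝ}
    (hq : Z.cyc = q₀ • θ⟦4⟧ Q + q₁ • wRe⟦4⟧ Q + q₂ • wIm⟦4⟧ Q) (hlt : q₀ < 8) :
    weilFunctional Z = 0 := by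
  have hdet : IsUnit Q.det := hQ.det_pos.ne'.isUnit
  exact Ladder.weilFunctional_eq_zero_of_thetaCoord_lt_eight Q hQ hJ hgen Z
    (fun I S' => twentyFour_dvd_intCoord hdet Z I S') hq hlt

/-- Contrapositive: **a counterexample to K1 has theta-degree `q₀ ≥ 8`.** [cite: Zharkov2020TropicalWeil, §2] -/
theorem thetaCoord_ge_eight_of_weilFunctional_ne_zero (hQ : Q.PosDef) (hJ : Q * weilJ 4 = weilJ 4 * Q)
    (hgen : IsWeilGeneric 4 Q) (Z : TropicalTorusCycle (2 * 4) 4 Q) {q₀ q₁ q₂ : ℝ}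
    (hq : Z.cyc = q₀ • θ⟦4⟧ Q + q₁ • wRe⟦4⟧ Q + q₂ • wIm⟦4⟧ Q) (hW : weilFunctional Z ≠ 0) :
    8 ≤ q₀ :=
  not_lt.mp fun h => hW (weilFunctional_eq_zero_of_thetaCoord_lt_eight Q hQ hJ hgen Z hq h)

/-- **THE RUNG, intrinsic form: hermitian mass `μ(Z) < 8 · det(P Q Pᴴ)` forces `W(Z) = 0`** (`μ(Z) = q₀ · det(P Q Pᴴ)`,
`hermPairing_cyc`, p331596). [cite: Zharkov2020TropicalWeil, §2] [cite: MikhalkinZharkov2014Eigenwave, Prop. 4.3 and Thm. 5.4] -/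
theorem weilFunctional_eq_zero_of_mass_lt_eight (hQ : Q.PosDef) (hJ : Q * weilJ 4 = weilJ 4 * Q)
    (hgen : IsWeilGeneric 4 Q) (Z : TropicalTorusCycle (2 * 4) 4 Q)
    (hμ : μ⟦Z⟧ < 8 * ((𝐏⟦4⟧ * Q.map ((↑) : ℝ → ℂ) * (𝐏⟦4⟧)ᴴ).det).re) :
    weilFunctional Z = 0 := by
  obtain ⟨q, hq⟩ := stub_rationalHodgeCoordinates Q hQ hJ hgen Z
  have h4 : (0 : ℕ) < 4 := by norm_num
  have hM0 := hermPairing_cyc Q Z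
  generalize hm : μ⟦Z⟧ = m at hμ hM0
  rw [hq, hermPairing_lincomb, hermPairing_thetaClass_eq_det, hermPairing_weilClassRe_eq_zero h4 Q hJ,
    hermPairing_weilClassIm_eq_zero h4 Q hJ, mul_zero, mul_zero, add_zero, add_zero] at hM0
  obtain ⟨hDre, hDim⟩ := det_frame_mul_map_mul_conjTranspose_pos Q hQ
  generalize hD : (𝐏⟦4⟧ * Q.map ((↑) : ℝ → ℂ) * (𝐏⟦4⟧)ᴴ).det = D at hDre hDim hM0 hμ
  obtain ⟨d, rfl⟩ : ∃ d : ℝ, (d : ℂ) = D := ⟨D.re, Complex.ext (by simp) (by simp [hDim])⟩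
  rw [Complex.ofReal_re] at hDre hμ
  have hmq : ((q 0 : ℚ) : ℝ) * d = m := by exact_mod_cast hM0
  have hq0 : ((q 0 : ℚ) : ℝ) < 8 := by
    by_contra hge
    push Not at hge
    have : 8 * d ≤ ((q 0 : ℚ) : ℝ) * d := mul_le_mul_of_nonneg_right hge hDre.le
    linarith
  exact weilFunctional_eq_zero_of_thetaCoord_lt_eight Q hQ hJ hgen Z hq hq0

/-- Contrapositive, intrinsic form: **a counterexample to K1 has mass `μ(Z) ≥ 8 · det(P Q Pᴴ)`.**
[cite: Zharkov2020TropicalWeil, §2] -/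
theorem mass_ge_of_weilFunctional_ne_zero_eight (hQ : Q.PosDef) (hJ : Q * weilJ 4 = weilJ 4 * Q)
    (hgen : IsWeilGeneric 4 Q) (Z : TropicalTorusCycle (2 * 4) 4 Q) (hW : weilFunctional Z ≠ 0) :
    8 * ((𝐏⟦4⟧ * Q.map ((↑) : ℝ → ℂ) * (𝐏⟦4⟧)ᴴ).det).re ≤ μ⟦Z⟧ :=
  not_lt.mp fun h => hW (weilFunctional_eq_zero_of_mass_lt_eight Q hQ hJ hgen Z h)

/-- **A counterexample of theta-degree exactly `8` is calibrated** (unconditional): `q₁² + q₂² = 1` and `q₁ q₂ = 0`, i.e. its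
class is one of `8θ₄ ± Re w`, `8θ₄ ± Im w`, on the boundary `64(q₁² + q₂²) = q₀²` of the calibration cone (`|W(Z)| = μ(Z)`).
[cite: Zharkov2020TropicalWeil, §2] [cite: MikhalkinZharkov2014Eigenwave, Prop. 4.3 and Thm. 5.4] -/
theorem weilCoords_sq_eq_one_of_thetaCoord_eq_eight (hQ : Q.PosDef) (hJ : Q * weilJ 4 = weilJ 4 * Q)
    (hgen : IsWeilGeneric 4 Q) (Z : TropicalTorusCycle (2 * 4) 4 Q) {q₀ q₁ q₂ : ℝ}
    (hq : Z.cyc = q₀ • θ⟦4⟧ Q + q₁ • wRe⟦4⟧ Q + q₂ • wIm⟦4⟧ Q) (h8 : q₀ = 8) (hW : weilFunctional Z ≠ 0) :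
    q₁ ^ 2 + q₂ ^ 2 = 1 ∧ (q₁ = 0 ∨ q₂ = 0) := by
  have hdet : IsUnit Q.det := hQ.det_pos.ne'.isUnit
  exact Ladder.weilCoords_sq_eq_one_of_thetaCoord_eq_eight Q hQ hJ hgen Z
    (fun I S' => twentyFour_dvd_intCoord hdet Z I S') hq h8 hW

end Summit.HodgeConjecture.HodgeConjecture.Theorems.TropicalWeilVanishing.Integrality

end
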